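import Literature.NumberTheory.Sieve.HeathBrownCubicPrimes
import Mathlib.Analysis.PSeries
import Mathlib.Analysis.Complex.ExponentialBounds
import Mathlib.Analysis.SpecialFunctions.Log.Deriv
import Mathlib.Analysis.Real.Pi.Bounds
import HarnessLib

/-!
# Heath-Brown 2001 (PLMS), p. 12: the Euler product `∏_{p ≥ 5} k(p) ≥ 0.91` and `C₂C₃ ≥ 6.1 × 10⁻³`

Topic `Literature/NumberTheory/Sieve`; a PROVED numerical layer (no named facts) under the named
facts `Irving2015_largestPrimeFactor_cubic` and `HeathBrown2001_largestPrimeFactor_cubic`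
(`LargestPrimeFactorCubic.lean`).  Both facts are reduced in the tree to Heath-Brown's weighted
sieve lower bound `S = X S₀ + S₁ ≥ (9.2 × 10⁻⁸ + o(1)) X` at `δ = 1/321`
(`Irving2015_largestPrimeFactor_cubic_of_HeathBrown_sieve`, `…Final.lean`, which needs the printed
constant; `LargestPrimeFactorCubic.HeathBrown2001_largestPrimeFactor_cubic_of_weights`,
`…HBWeights.lean`, which needs any constant `≥ 10⁻⁹⁰`).  The main term is evaluated in
D. R. Heath-Brown, *The largest prime factor of `X³ + 2`*, Proc. London Math. Soc. (3) 82 (2001)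
554–596, Lemmas 6–9 (pp. 10–11 of the held text `paper:heathbrown2001-largest-prime-factor-i-x-i-sup`):
"It follows from Lemmas 8 and 9 that `S₀ ≥ C₂C₃L(δ) + o(1)`. In view of the definitions of the
various constants we may calculate that `C₂C₃ = (log 2)(log 4/3)/(3π²) ∏_{p ≥ 5} k(p)`, where

  `k(p) = (1 − p⁻³)⁻¹` if `g(p) = 0`,  `1 − (p + 1)⁻²` if `g(p) = 1`,
  `1 − (3p² − 4p − 1)/((p − 1)³(p + 1))` if `g(p) = 3`

[`g(p) = #{P : N(P) = p}`, Lemma 6, p. 10]. This yields `∏_{p ≥ 5} k(p) ≥ 0.91`, and hence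
`C₂C₃ ≥ 6.1 × 10⁻³`. If we now choose `δ = 1/321`, as suggested by Lemma 5, we find that
`S₀ ≥ C₂C₃L(δ) + o(1) ≥ 9.2 × 10⁻⁸`, for large enough `X`" (pp. 11–12), with
`L(δ) = (log(1 + 7δ/5))(log(1 + 7δ/6))` (Lemma 8, p. 11).

This file PROVES the two numerical displays and the final inequality:

* `HeathBrown2001.kFactor p` — `k(p)` by cases on `g(p)`, read through the tree's decidable count
  `CubicPrimes.cubeRootTwoCount p = #{x (mod p) : x³ ≡ 2}` (`HeathBrownCubicPrimes.lean`), which for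
  a prime `p` is the number of first-degree prime ideals of `ℚ(∛2)` above `p`
  (`CubicSieve.card_primesAbove_filter_absNorm_eq`, `idealNormCount_prime_eq` in the tree);
  `HeathBrown2001.kProd N = ∏_{5 ≤ p ≤ N} k(p)`.
* `HeathBrown2001.kProd_99` — the exact finite product `∏_{5 ≤ p ≤ 99} k(p) ≥ 0.9565` (the `23`
  values `g(5), …, g(97)` by `decide`, the product by `norm_num`);
  `HeathBrown2001.one_sub_le_kFactor`, `kFactor_le_one_add` — `1 − 4/p² ≤ k(p) ≤ 1 + 2/p³` for `p ≥ 5`;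
  `HeathBrown2001.prod_kFactor_tail_ge` — `∏_{99 < p ≤ N} k(p) ≥ 1 − 4/99` (Weierstrass'
  inequality `∏(1 − a_p) ≥ 1 − ∑ a_p` and `∑_{n > 99} n⁻² ≤ 1/99`);
* **`HeathBrown2001.kProd_ge`** — `∏_{5 ≤ p ≤ N} k(p) ≥ 0.917 (≥ 0.91)` for every `N ≥ 99`, and
  **`HeathBrown2001.exists_tendsto_kProd`** — the infinite product converges:
  `∏_{5 ≤ p ≤ N} k(p) → P` with `0.917 ≤ P` (the true value is `0.9547…`);
* **`HeathBrown2001.C2C3_numeric`** — "hence `C₂C₃ ≥ 6.1 × 10⁻³`":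
  `0.91 ≤ P → 6.1 × 10⁻³ ≤ (log 2)(log 4/3)/(3π²) · P` (`log 2 > 0.6931471803`,
  `log 4/3 > 0.2876755` from the series of `−log(1 − 1/4)`, `π < 3.141593`);
* `HeathBrown2001.S0_numeric` — "`S₀ ≥ C₂C₃L(δ) ≥ 9.2 × 10⁻⁸`" at `δ = 1/321`:
  `0.91 ≤ P → 9.2 × 10⁻⁸ ≤ (log 2)(log 4/3)/(3π²) · P · log(1 + 7δ/5) log(1 + 7δ/6)`.

What these serve: with Lemma 8 (`S₀ ≥ {C₂ + o(1)} δ L(δ) (log X) ∏_{p < X^δ}(1 − g(p)/p)`), Lemma 9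
(`∏_{p ≤ x}(1 − g(p)/p) ∼ C₃/log x`, Mertens' theorem for `ℚ(∛2)`: tree `CubicSieve.mertensK_grouped`,
`gamma₀_eq`) and the identity `C₂C₃ = (log 2)(log 4/3)/(3π²) ∏_{p≥5} k(p)` — none of which is
proved here — they give the main-term half of the input (A) of `…_of_HeathBrown_sieve` with
Heath-Brown's own constant, which Irving's `ϖ = 10⁻⁵²` requires (any `S₀ − (tails) ≥ 8.4 × 10⁻⁸`).

## References

* D. R. Heath-Brown, *The largest prime factor of `X³ + 2`*, Proc. London Math. Soc. (3) 82 (2001)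
  554–596, doi:10.1112/plms/82.3.554: Lemmas 6, 8, 9 and the displays of pp. 11–12 (preprint
  pagination of the held text). [`HeathBrown2001LargestPrimeFactorCubic`]
* A. J. Irving, *The largest prime factor of `X³ + 2`*, arXiv:1412.0024; Acta Arith. 171 (2015)
  67–80, Lemma 2.3 (`S ≥ (9.2 × 10⁻⁸ + o(1))X`, quoting the above). [`Irving2014LargestPrimeFactorCubic`]

## Mathlib / tree search

Tree: `CubicPrimes.cubeRootTwoCount` with `cubeRootTwoCount_five/_seven/_thirtyOne` (by `decide`;
`HeathBrownCubicPrimes.lean`); `HeathBrown2001.numerics_p12_S0` (`…Constants.lean`, the last step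
GIVEN `C₂C₃ ≥ 6.1 × 10⁻³`; re-derived here as `S0_numeric` from `P ≥ 0.91` to keep this chain
self-contained).  Mathlib: `Real.log_two_gt_d9`, `Real.abs_log_sub_add_sum_range_le`,
`Real.pi_lt_d6`, `Real.summable_one_div_nat_pow`, `Summable.of_norm_bounded`,
`HasSum.tendsto_sum_nat`, `Real.one_sub_inv_le_log_of_pos`, `Real.log_le_sub_one_of_pos`,
`Finset.prod_Ioc_consecutive`, `Finset.prod_Ico_eq_prod_range`.  `lean search 'kFactor|kProd'`: no
prior hits.
-/

noncomputable section

open Finset Filter Topology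

namespace Literature.NumberTheory.Sieve.HeathBrown2001

open CubicPrimes (cubeRootTwoCount)

/-! ### The factors `k(p)` -/

/-- **Heath-Brown's `k(p)`** (p. 12): `(1 − p⁻³)⁻¹` if `g(p) = 0`, `1 − (p+1)⁻²` if `g(p) = 1`, and
`1 − (3p² − 4p − 1)/((p−1)³(p+1))` otherwise (`g(p) = 3`), where `g(p)` is read as the number of
solutions of `x³ ≡ 2 (mod p)` (`= #{P : N(P) = p}` for a prime `p`).
[cite: HeathBrown2001LargestPrimeFactorCubic, p. 12 (display for k(p))] -/
def kFactor (p : ℕ) : ℝ :=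
  if cubeRootTwoCount p = 0 then (1 - ((p : ℝ) ^ 3)⁻¹)⁻¹
  else if cubeRootTwoCount p = 1 then 1 - (((p : ℝ) + 1) ^ 2)⁻¹
  else 1 - (3 * (p : ℝ) ^ 2 - 4 * p - 1) / (((p : ℝ) - 1) ^ 3 * (p + 1))

/-- The partial products `∏_{5 ≤ p ≤ N, p prime} k(p)` (`Ioc 4 N = {5, …, N}`).
[cite: HeathBrown2001LargestPrimeFactorCubic, p. 12 (`∏_{p≥5} k(p)`)] -/
def kProd (N : ℕ) : ℝ := ∏ p ∈ (Ioc 4 N).filter Nat.Prime, kFactor p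

/-- `kProd` unfolded. [folklore] -/
theorem kProd_def (N : ℕ) : kProd N = ∏ p ∈ (Ioc 4 N).filter Nat.Prime, kFactor p := rfl

/-! ### The values `g(p)` for `11 ≤ p ≤ 97` (`g(5) = 1`, `g(7) = 0`, `g(31) = 3` are in the tree) -/

/-- `g(11) = 1`. [folklore] -/
private theorem crt_11 : cubeRootTwoCount 11 = 1 := by decide
/-- `g(13) = 0`. [folklore] -/
private theorem crt_13 : cubeRootTwoCount 13 = 0 := by decide
/-- `g(17) = 1`. [folklore] -/
private theorem crt_17 : cubeRootTwoCount 17 = 1 := by decide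
/-- `g(19) = 0`. [folklore] -/
private theorem crt_19 : cubeRootTwoCount 19 = 0 := by decide
/-- `g(23) = 1`. [folklore] -/
private theorem crt_23 : cubeRootTwoCount 23 = 1 := by decide
/-- `g(29) = 1`. [folklore] -/
private theorem crt_29 : cubeRootTwoCount 29 = 1 := by decide
/-- `g(37) = 0`. [folklore] -/
private theorem crt_37 : cubeRootTwoCount 37 = 0 := by decide
/-- `g(41) = 1`. [folklore] -/
private theorem crt_41 : cubeRootTwoCount 41 = 1 := by decide
/-- `g(43) = 3`. [folklore] -/
private theorem crt_43 : cubeRootTwoCount 43 = 3 := by decide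
/-- `g(47) = 1`. [folklore] -/
private theorem crt_47 : cubeRootTwoCount 47 = 1 := by decide
/-- `g(53) = 1`. [folklore] -/
private theorem crt_53 : cubeRootTwoCount 53 = 1 := by decide
/-- `g(59) = 1`. [folklore] -/
private theorem crt_59 : cubeRootTwoCount 59 = 1 := by decide
/-- `g(61) = 0`. [folklore] -/
private theorem crt_61 : cubeRootTwoCount 61 = 0 := by decide
/-- `g(67) = 0`. [folklore] -/
private theorem crt_67 : cubeRootTwoCount 67 = 0 := by decide
/-- `g(71) = 1`. [folklore] -/
private theorem crt_71 : cubeRootTwoCount 71 = 1 := by decide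
/-- `g(73) = 0`. [folklore] -/
private theorem crt_73 : cubeRootTwoCount 73 = 0 := by decide
/-- `g(79) = 0`. [folklore] -/
private theorem crt_79 : cubeRootTwoCount 79 = 0 := by decide
/-- `g(83) = 1`. [folklore] -/
private theorem crt_83 : cubeRootTwoCount 83 = 1 := by decide
/-- `g(89) = 1`. [folklore] -/
private theorem crt_89 : cubeRootTwoCount 89 = 1 := by decide
/-- `g(97) = 0`. [folklore] -/
private theorem crt_97 : cubeRootTwoCount 97 = 0 := by decide

/-- **The finite part**: `∏_{5 ≤ p ≤ 99} k(p) ≥ 0.9565` (exact value `0.95652…`; the primes with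
`g = 1` are `5, 11, 17, 23, 29, 41, 47, 53, 59, 71, 83, 89`, with `g = 3`: `31, 43`, with `g = 0`:
`7, 13, 19, 37, 61, 67, 73, 79, 97`). [cite: HeathBrown2001LargestPrimeFactorCubic, p. 12] -/
theorem kProd_99 : (9565 / 10000 : ℝ) ≤ kProd 99 := by
  unfold kProd
  rw [Finset.prod_filter, show Ioc 4 99 = Ico 5 100 by rfl, Finset.prod_Ico_eq_prod_range]
  simp only [Finset.prod_range_succ, Finset.prod_range_zero]
  norm_num [kFactor, CubicPrimes.cubeRootTwoCount_five, CubicPrimes.cubeRootTwoCount_seven,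
    crt_11, crt_13, crt_17, crt_19, crt_23, crt_29, CubicPrimes.cubeRootTwoCount_thirtyOne, crt_37,
    crt_41, crt_43, crt_47, crt_53, crt_59, crt_61, crt_67, crt_71, crt_73, crt_79, crt_83, crt_89, crt_97]

/-! ### Uniform bounds `1 − 4/p² ≤ k(p) ≤ 1 + 2/p³` for `p ≥ 5` -/

/-- `k(p) > 0` for `p ≥ 5` (in the third case `(p−1)³(p+1) − (3p² − 4p − 1) = p(p−2)(p²−3) > 0`).
[cite: HeathBrown2001LargestPrimeFactorCubic, p. 12] -/
theorem kFactor_pos {p : ℕ} (hp : 5 ≤ p) : 0 < kFactor p := by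
  have hp5 : (5 : ℝ) ≤ p := by exact_mod_cast hp
  have hp3 : (125 : ℝ) ≤ (p : ℝ) ^ 3 := le_trans (by norm_num) (pow_le_pow_left₀ (by norm_num) hp5 3)
  unfold kFactor
  split_ifs
  · have h1 : (1 : ℝ) < (p : ℝ) ^ 3 := by linarith
    have h2 : ((p : ℝ) ^ 3)⁻¹ < 1 := inv_lt_one_of_one_lt₀ h1
    exact inv_pos.mpr (by linarith)
  · have h1 : (1 : ℝ) < ((p : ℝ) + 1) ^ 2 := by nlinarith
    have h2 : (((p : ℝ) + 1) ^ 2)⁻¹ < 1 := inv_lt_one_of_one_lt₀ h1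
    linarith
  · have hp1 : (0 : ℝ) < (p : ℝ) - 1 := by linarith
    have hden : (0 : ℝ) < ((p : ℝ) - 1) ^ 3 * (p + 1) := mul_pos (pow_pos hp1 3) (by linarith)
    rw [sub_pos, div_lt_one hden]
    nlinarith [mul_pos (mul_pos (by linarith : (0 : ℝ) < p) (by linarith : (0 : ℝ) < (p : ℝ) - 2))
      (by nlinarith : (0 : ℝ) < (p : ℝ) ^ 2 - 3)]

/-- **Lower bound** `k(p) ≥ 1 − 4/p²` for `p ≥ 5` (case `g = 0`: `k(p) ≥ 1`; case `g = 1`: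
`(p+1)⁻² ≤ 4p⁻²`; case `g = 3`: `(3p² − 4p − 1)p² ≤ 4(p−1)³(p+1)`, i.e.
`0 ≤ p⁴ − 4p³ + p² + 8p − 4`). [cite: HeathBrown2001LargestPrimeFactorCubic, p. 12] -/
theorem one_sub_le_kFactor {p : ℕ} (hp : 5 ≤ p) : 1 - 4 / (p : ℝ) ^ 2 ≤ kFactor p := by
  have hp5 : (5 : ℝ) ≤ p := by exact_mod_cast hp
  have hp0 : (0 : ℝ) < p := by linarith
  have h4 : (0 : ℝ) ≤ 4 / (p : ℝ) ^ 2 := by positivity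
  have hp3 : (125 : ℝ) ≤ (p : ℝ) ^ 3 := le_trans (by norm_num) (pow_le_pow_left₀ (by norm_num) hp5 3)
  unfold kFactor
  split_ifs
  · have h1 : (1 : ℝ) < (p : ℝ) ^ 3 := by linarith
    have h2 : ((p : ℝ) ^ 3)⁻¹ < 1 := inv_lt_one_of_one_lt₀ h1
    have h3 : (0 : ℝ) < ((p : ℝ) ^ 3)⁻¹ := by positivity
    have : (1 : ℝ) ≤ (1 - ((p : ℝ) ^ 3)⁻¹)⁻¹ := one_le_inv_iff₀.mpr ⟨by linarith, by linarith⟩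
    linarith
  · have : (((p : ℝ) + 1) ^ 2)⁻¹ ≤ 4 / (p : ℝ) ^ 2 := by
      rw [inv_eq_one_div, div_le_div_iff₀ (by positivity) (by positivity)]
      nlinarith
    linarith
  · have hp1 : (0 : ℝ) < (p : ℝ) - 1 := by linarith
    have hden : (0 : ℝ) < ((p : ℝ) - 1) ^ 3 * (p + 1) := mul_pos (pow_pos hp1 3) (by linarith)
    have : (3 * (p : ℝ) ^ 2 - 4 * p - 1) / (((p : ℝ) - 1) ^ 3 * (p + 1)) ≤ 4 / (p : ℝ) ^ 2 := by
      rw [div_le_div_iff₀ hden (by positivity)]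
      have hb : (1 : ℝ) ≤ (p : ℝ) - 4 := by linarith
      have h1 : (125 : ℝ) ≤ (p : ℝ) ^ 3 * ((p : ℝ) - 4) := by
        nlinarith [mul_le_mul hp3 hb (by norm_num) (by positivity)]
      -- `4(p−1)³(p+1) − (3p²−4p−1)p² = p³(p−4) + p² + 8p − 4`
      have hid : 4 * (((p : ℝ) - 1) ^ 3 * (p + 1)) - (3 * (p : ℝ) ^ 2 - 4 * p - 1) * (p : ℝ) ^ 2 =
          (p : ℝ) ^ 3 * ((p : ℝ) - 4) + (p : ℝ) ^ 2 + 8 * p - 4 := by ring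
      nlinarith
    linarith

/-- **Upper bound** `k(p) ≤ 1 + 2/p³` for `p ≥ 5` (case `g = 0`: `(1 − p⁻³)⁻¹ = 1 + 1/(p³ − 1)`;
the other two factors are `≤ 1`). [cite: HeathBrown2001LargestPrimeFactorCubic, p. 12] -/
theorem kFactor_le_one_add {p : ℕ} (hp : 5 ≤ p) : kFactor p ≤ 1 + 2 / (p : ℝ) ^ 3 := by
  have hp5 : (5 : ℝ) ≤ p := by exact_mod_cast hp
  have hp0 : (0 : ℝ) < p := by linarith
  have h2 : (0 : ℝ) ≤ 2 / (p : ℝ) ^ 3 := by positivity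
  have hp3 : (125 : ℝ) ≤ (p : ℝ) ^ 3 := le_trans (by norm_num) (pow_le_pow_left₀ (by norm_num) hp5 3)
  unfold kFactor
  split_ifs
  · set q : ℝ := (p : ℝ) ^ 3 with hq
    have hq1 : (125 : ℝ) ≤ q := hp3
    have heq : (1 - q⁻¹)⁻¹ = q / (q - 1) := by
      field_simp
    rw [heq, div_le_iff₀ (by linarith)]
    have : 2 / q * q = 2 := by field_simp
    nlinarith
  · have : (0 : ℝ) ≤ (((p : ℝ) + 1) ^ 2)⁻¹ := by positivity
    linarith
  · have hp1 : (0 : ℝ) < (p : ℝ) - 1 := by linarith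
    have hden : (0 : ℝ) < ((p : ℝ) - 1) ^ 3 * (p + 1) := mul_pos (pow_pos hp1 3) (by linarith)
    have : (0 : ℝ) ≤ (3 * (p : ℝ) ^ 2 - 4 * p - 1) / (((p : ℝ) - 1) ^ 3 * (p + 1)) :=
      div_nonneg (by nlinarith) hden.le
    linarith

/-- The partial products are positive. [folklore] -/
theorem kProd_pos (N : ℕ) : 0 < kProd N := by
  unfold kProd
  refine Finset.prod_pos fun p hp => kFactor_pos ?_
  rw [mem_filter, mem_Ioc] at hp
  omega

/-! ### Weierstrass' inequality and the tail `∑_{n > 99} n⁻² ≤ 1/99` -/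

/-- **Weierstrass' product inequality**: for `0 ≤ a_i ≤ 1`, `1 − ∑ a_i ≤ ∏ (1 − a_i)`. [folklore] -/
theorem one_sub_sum_le_prod_one_sub {ι : Type*} [DecidableEq ι] (s : Finset ι) (a : ι → ℝ)
    (h0 : ∀ i ∈ s, 0 ≤ a i) (h1 : ∀ i ∈ s, a i ≤ 1) :
    1 - ∑ i ∈ s, a i ≤ ∏ i ∈ s, (1 - a i) := by
  induction s using Finset.induction_on with
  | empty => simp
  | insert j s hj ih =>
    have h0' : ∀ i ∈ s, 0 ≤ a i := fun i hi => h0 i (mem_insert_of_mem hi)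
    have h1' : ∀ i ∈ s, a i ≤ 1 := fun i hi => h1 i (mem_insert_of_mem hi)
    have hih := ih h0' h1'
    have hP1 : ∏ i ∈ s, (1 - a i) ≤ 1 :=
      Finset.prod_le_one (fun i hi => by linarith [h1' i hi]) (fun i hi => by linarith [h0' i hi])
    have haj0 : 0 ≤ a j := h0 j (mem_insert_self j s)
    rw [sum_insert hj, prod_insert hj]
    nlinarith [mul_le_mul_of_nonneg_left hP1 haj0]

/-- `∑_{k < n ≤ N} n⁻² ≤ 1/k` for `k ≥ 1` (telescoping `n⁻² ≤ (n−1)⁻¹ − n⁻¹`). [folklore] -/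
theorem sum_Ioc_inv_sq_le {k : ℕ} (hk : 1 ≤ k) (N : ℕ) :
    ∑ n ∈ Ioc k N, 1 / (n : ℝ) ^ 2 ≤ 1 / (k : ℝ) := by
  have hk0 : (0 : ℝ) < k := by exact_mod_cast hk
  rcases le_or_gt N k with hN | hN
  · rw [Finset.Ioc_eq_empty (by omega), sum_empty]; positivity
  · -- `∑_{k<n≤N} n⁻² ≤ 1/k − 1/N` for `N ≥ k`, by induction
    suffices h : ∀ M : ℕ, k ≤ M → ∑ n ∈ Ioc k M, 1 / (n : ℝ) ^ 2 ≤ 1 / (k : ℝ) - 1 / (M : ℝ) by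
      have := h N hN.le
      have hN0 : (0 : ℝ) < N := by exact_mod_cast (lt_of_le_of_lt (Nat.zero_le k) hN)
      linarith [one_div_pos.mpr hN0]
    intro M hM
    induction M, hM using Nat.le_induction with
    | base => simp
    | succ M hkM ih =>
      rw [Finset.sum_Ioc_succ_top hkM]
      have hM0 : (0 : ℝ) < M := by exact_mod_cast (lt_of_lt_of_le hk hkM)
      have hstep : 1 / ((M + 1 : ℕ) : ℝ) ^ 2 ≤ 1 / (M : ℝ) - 1 / ((M + 1 : ℕ) : ℝ) := by
        push_cast
        rw [div_sub_div _ _ hM0.ne' (by linarith), div_le_div_iff₀ (by positivity) (by positivity)]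
        nlinarith
      linarith

/-- **The tail**: `∏_{99 < p ≤ N, p prime} k(p) ≥ 1 − 4/99` for every `N`.
[cite: HeathBrown2001LargestPrimeFactorCubic, p. 12] -/
theorem prod_kFactor_tail_ge (N : ℕ) :
    (1 - 4 / 99 : ℝ) ≤ ∏ p ∈ (Ioc 99 N).filter Nat.Prime, kFactor p := by
  set S := (Ioc 99 N).filter Nat.Prime with hS
  have hmem : ∀ p ∈ S, 100 ≤ p := fun p hp => by
    rw [hS, mem_filter, mem_Ioc] at hp; omega
  have hcast : ∀ p ∈ S, (100 : ℝ) ≤ p := fun p hp => by exact_mod_cast hmem p hp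
  -- `∏ k(p) ≥ ∏ (1 − 4/p²)`
  have h1 : ∏ p ∈ S, (1 - 4 / (p : ℝ) ^ 2) ≤ ∏ p ∈ S, kFactor p := by
    refine Finset.prod_le_prod (fun p hp => ?_) (fun p hp => one_sub_le_kFactor (by linarith [hmem p hp]))
    have := hcast p hp
    rw [sub_nonneg, div_le_one (by positivity)]; nlinarith
  -- Weierstrass
  have h2 : 1 - ∑ p ∈ S, 4 / (p : ℝ) ^ 2 ≤ ∏ p ∈ S, (1 - 4 / (p : ℝ) ^ 2) := by
    refine one_sub_sum_le_prod_one_sub S (fun p => 4 / (p : ℝ) ^ 2) (fun p _ => by positivity)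
      (fun p hp => ?_)
    have := hcast p hp
    rw [div_le_one (by positivity)]; nlinarith
  -- the sum over primes is at most the full sum, `≤ 4/99`
  have h3 : ∑ p ∈ S, 4 / (p : ℝ) ^ 2 ≤ ∑ n ∈ Ioc 99 N, 4 / (n : ℝ) ^ 2 :=
    Finset.sum_le_sum_of_subset_of_nonneg (filter_subset _ _) (fun n _ _ => by positivity)
  have h4 : ∑ n ∈ Ioc 99 N, 4 / (n : ℝ) ^ 2 ≤ 4 / 99 := by
    have h := sum_Ioc_inv_sq_le (show 1 ≤ 99 by norm_num) N
    rw [show ∑ n ∈ Ioc 99 N, 4 / (n : ℝ) ^ 2 = 4 * ∑ n ∈ Ioc 99 N, 1 / (n : ℝ) ^ 2 by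
      rw [mul_sum]; refine sum_congr rfl fun n _ => ?_; ring]
    have h' : ∑ n ∈ Ioc 99 N, 1 / (n : ℝ) ^ 2 ≤ 1 / 99 := by exact_mod_cast h
    linarith
  linarith

/-! ### The product bound and the convergence of `∏_{p ≥ 5} k(p)` -/

/-- Splitting at `99`: `kProd N = kProd 99 · ∏_{99 < p ≤ N} k(p)` for `N ≥ 99`. [folklore] -/
theorem kProd_eq_mul {N : ℕ} (hN : 99 ≤ N) :
    kProd N = kProd 99 * ∏ p ∈ (Ioc 99 N).filter Nat.Prime, kFactor p := by
  unfold kProd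
  rw [Finset.prod_filter, Finset.prod_filter, Finset.prod_filter,
    Finset.prod_Ioc_consecutive _ (by norm_num : 4 ≤ 99) hN]

/-- **`∏_{5 ≤ p ≤ N} k(p) ≥ 0.917` for every `N ≥ 99`** (`0.9565 × 95/99 = 0.91785…`).
[cite: HeathBrown2001LargestPrimeFactorCubic, p. 12 ("This yields ∏_{p≥5} k(p) ≥ 0.91")] -/
theorem kProd_ge {N : ℕ} (hN : 99 ≤ N) : (917 / 1000 : ℝ) ≤ kProd N := by
  rw [kProd_eq_mul hN]
  have h1 := kProd_99
  have h2 := prod_kFactor_tail_ge N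
  calc (917 / 1000 : ℝ) ≤ 9565 / 10000 * (1 - 4 / 99) := by norm_num
    _ ≤ _ := mul_le_mul h1 h2 (by norm_num) (kProd_pos 99).le

/-- Heath-Brown's printed form: `∏_{5 ≤ p ≤ N} k(p) ≥ 0.91` for `N ≥ 99`.
[cite: HeathBrown2001LargestPrimeFactorCubic, p. 12] -/
theorem kProd_ge' {N : ℕ} (hN : 99 ≤ N) : (91 / 100 : ℝ) ≤ kProd N :=
  le_trans (by norm_num) (kProd_ge hN)

/-- The logarithmic terms `log k(p)` at the primes `p ≥ 5` (zero elsewhere). [folklore] -/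
def logTerm (n : ℕ) : ℝ := if 5 ≤ n ∧ n.Prime then Real.log (kFactor n) else 0

/-- `|log k(p)| ≤ 8/p²` (from `1 − 4/p² ≤ k(p) ≤ 1 + 2/p³`, `1 − 1/x ≤ log x ≤ x − 1`); hence
`|logTerm n| ≤ 8 · (1/n²)` for all `n`. [folklore] -/
theorem abs_logTerm_le (n : ℕ) : |logTerm n| ≤ 8 * (1 / (n : ℝ) ^ 2) := by
  unfold logTerm
  split_ifs with h
  · obtain ⟨h5, -⟩ := h
    have hn5 : (5 : ℝ) ≤ n := by exact_mod_cast h5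
    have hn0 : (0 : ℝ) < n := by linarith
    have hk0 := kFactor_pos h5
    have hlo := one_sub_le_kFactor h5
    have hhi := kFactor_le_one_add h5
    have hu : 4 / (n : ℝ) ^ 2 ≤ 4 / 25 := by
      rw [div_le_div_iff₀ (by positivity) (by positivity)]; nlinarith
    have hu0 : (0 : ℝ) ≤ 4 / (n : ℝ) ^ 2 := by positivity
    have h23 : 2 / (n : ℝ) ^ 3 ≤ 4 / (n : ℝ) ^ 2 := by
      rw [div_le_div_iff₀ (by positivity) (by positivity)]; nlinarith
    set u : ℝ := 4 / (n : ℝ) ^ 2 with hu'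
    have h5 : 8 * (1 / (n : ℝ) ^ 2) = 2 * u := by rw [hu']; ring
    rw [abs_le, h5]
    constructor
    · -- lower: `log k ≥ 1 − 1/k ≥ −(4/p²)/(1 − 4/p²) ≥ −8/p²`
      have h1 := Real.one_sub_inv_le_log_of_pos hk0
      have hm : 1 - u ≤ kFactor n := hlo
      have hm0 : (0 : ℝ) < 1 - u := by linarith
      have h2 : (kFactor n)⁻¹ ≤ (1 - u)⁻¹ := (inv_le_inv₀ hk0 hm0).mpr hm
      have h3 : 1 - (1 - u)⁻¹ = -(u / (1 - u)) := by field_simp; ring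
      have h4 : u / (1 - u) ≤ 2 * u := by
        rw [div_le_iff₀ hm0]; nlinarith
      linarith
    · -- upper: `log k ≤ k − 1 ≤ 2/p³ ≤ 4/p² ≤ 8/p²`
      have h1 := Real.log_le_sub_one_of_pos hk0
      linarith
  · simp only [abs_zero]; positivity

/-- `logTerm` is absolutely summable. [folklore] -/
theorem summable_logTerm : Summable logTerm := by
  have hg : Summable fun n : ℕ => 8 * (1 / (n : ℝ) ^ 2) :=
    (Real.summable_one_div_nat_pow.mpr one_lt_two).mul_left 8
  exact Summable.of_norm_bounded hg fun n => by rw [Real.norm_eq_abs]; exact abs_logTerm_le n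

/-- `kProd N = exp(∑_{n ≤ N} logTerm n)`. [folklore] -/
theorem kProd_eq_exp_sum (N : ℕ) : kProd N = Real.exp (∑ n ∈ range (N + 1), logTerm n) := by
  have hset : (range (N + 1)).filter (fun n => 5 ≤ n ∧ n.Prime) = (Ioc 4 N).filter Nat.Prime := by
    ext n
    simp only [mem_filter, mem_range, mem_Ioc]
    constructor
    · rintro ⟨h1, h2, h3⟩; exact ⟨⟨by omega, by omega⟩, h3⟩
    · rintro ⟨⟨h1, h2⟩, h3⟩; exact ⟨by omega, by omega, h3⟩
  unfold logTerm
  rw [← Finset.sum_filter, hset, Real.exp_sum, kProd]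
  refine Finset.prod_congr rfl fun p hp => ?_
  rw [mem_filter, mem_Ioc] at hp
  rw [Real.exp_log (kFactor_pos (by omega))]

/-- **Convergence of `∏_{p ≥ 5} k(p)`** with the bound: there is `P ≥ 0.917 (≥ 0.91)` with
`∏_{5 ≤ p ≤ N} k(p) → P`. [cite: HeathBrown2001LargestPrimeFactorCubic, p. 12] -/
theorem exists_tendsto_kProd : ∃ P : ℝ, (917 / 1000 : ℝ) ≤ P ∧ Tendsto kProd atTop (𝓝 P) := by
  have hS := summable_logTerm.hasSum.tendsto_sum_nat
  have hT : Tendsto kProd atTop (𝓝 (Real.exp (∑' n, logTerm n))) := by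
    have h := (Real.continuous_exp.tendsto _).comp (hS.comp (tendsto_add_atTop_nat 1))
    refine h.congr fun N => ?_
    simp only [Function.comp_apply]
    exact (kProd_eq_exp_sum N).symm
  refine ⟨_, ?_, hT⟩
  exact ge_of_tendsto hT (eventually_atTop.2 ⟨99, fun N hN => kProd_ge hN⟩)

/-! ### "Hence `C₂C₃ ≥ 6.1 × 10⁻³`" and "`S₀ ≥ 9.2 × 10⁻⁸`" -/

/-- `log(4/3) ≥ 0.2876755` (eight terms of `−log(1 − 1/4) = ∑ 4^{-j}/j`). [folklore] -/
theorem log_four_thirds_ge : (0.2876755 : ℝ) ≤ Real.log (4 / 3) := by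
  have h := Real.abs_log_sub_add_sum_range_le (show |(1 / 4 : ℝ)| < 1 by
    rw [abs_of_pos (by norm_num)]; norm_num) 8
  rw [abs_le] at h
  have hlog : Real.log (1 - 1 / 4) = -Real.log (4 / 3) := by
    rw [show (1 : ℝ) - 1 / 4 = (4 / 3)⁻¹ by norm_num, Real.log_inv]
  rw [hlog, abs_of_pos (by norm_num : (0 : ℝ) < 1 / 4)] at h
  have h2 := h.2
  simp only [Finset.sum_range_succ, Finset.sum_range_zero] at h2
  norm_num at h2
  linarith

/-- **"and hence `C₂C₃ ≥ 6.1 × 10⁻³`"**: for any `P ≥ 0.91` (the value of `∏_{p≥5} k(p)`),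
`(log 2)(log 4/3)/(3π²) · P ≥ 6.1 × 10⁻³`. [cite: HeathBrown2001LargestPrimeFactorCubic, p. 12] -/
theorem C2C3_numeric {P : ℝ} (hP : (91 / 100 : ℝ) ≤ P) :
    (61 / 10000 : ℝ) ≤ Real.log 2 * Real.log (4 / 3) / (3 * Real.pi ^ 2) * P := by
  have h2 : (0.6931471803 : ℝ) ≤ Real.log 2 := Real.log_two_gt_d9.le
  have h43 : (0.2876755 : ℝ) ≤ Real.log (4 / 3) := log_four_thirds_ge
  have hpi : Real.pi ≤ 3.141593 := Real.pi_lt_d6.le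
  have hpi0 : 0 < Real.pi := Real.pi_pos
  calc (61 / 10000 : ℝ) ≤ 0.6931471803 * 0.2876755 / (3 * 3.141593 ^ 2) * (91 / 100) := by
        norm_num
    _ ≤ Real.log 2 * Real.log (4 / 3) / (3 * Real.pi ^ 2) * P := by
        gcongr

/-- **"`S₀ ≥ C₂C₃L(δ) + o(1) ≥ 9.2 × 10⁻⁸`" at `δ = 1/321`**, `L(δ) = log(1 + 7δ/5) log(1 + 7δ/6)`:
for any `P ≥ 0.91`, `(log 2)(log 4/3)/(3π²) · P · L(1/321) ≥ 9.2 × 10⁻⁸` (by `log(1+t) ≥ t/(1+t)`).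
[cite: HeathBrown2001LargestPrimeFactorCubic, p. 12 and Lemma 8 (L(δ))] -/
theorem S0_numeric {P : ℝ} (hP : (91 / 100 : ℝ) ≤ P) :
    (9.2 / 10 ^ 8 : ℝ) ≤ Real.log 2 * Real.log (4 / 3) / (3 * Real.pi ^ 2) * P *
      (Real.log (1 + 7 * (1 / 321) / 5) * Real.log (1 + 7 * (1 / 321) / 6)) := by
  have hC := C2C3_numeric hP
  have hL1 : (1 - (1 + 7 * (1 / 321) / 5)⁻¹ : ℝ) ≤ Real.log (1 + 7 * (1 / 321) / 5) :=
    Real.one_sub_inv_le_log_of_pos (by norm_num)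
  have hL2 : (1 - (1 + 7 * (1 / 321) / 6)⁻¹ : ℝ) ≤ Real.log (1 + 7 * (1 / 321) / 6) :=
    Real.one_sub_inv_le_log_of_pos (by norm_num)
  have hL1' : (7 / 1612 : ℝ) ≤ Real.log (1 + 7 * (1 / 321) / 5) := le_trans (by norm_num) hL1
  have hL2' : (7 / 1933 : ℝ) ≤ Real.log (1 + 7 * (1 / 321) / 6) := le_trans (by norm_num) hL2
  calc (9.2 / 10 ^ 8 : ℝ) ≤ 61 / 10000 * ((7 / 1612) * (7 / 1933)) := by norm_num
    _ ≤ _ := by gcongr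

end Literature.NumberTheory.Sieve.HeathBrown2001
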